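import Mathlib
import HarnessLib
import Summits.HubbardSuperconductivity.HubbardSuperconductivity.Theorems.KLProgrammeKLRegimeEngineLastStepResponseBracketFlowSharpEnv
import Summits.HubbardSuperconductivity.HubbardSuperconductivity.Theorems.KLProgrammeKLRegimeEngineLastStepAliasRowsGradedS

/-!
# K3 gen-8-FLOW (stmt 20437, stub (C), located item #20, cure (δ′) «LAST-STEP SWAP», layer F3j′): THE #20 (δ′) DOOR WITH GRADED ORDER-`s` ENVELOPES —
# `lastResponse_bracket_flow_final_graded` (located «(C)-S-ROW-GRADING», cell gate-hubbard-kl, seat p2 g21)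

Same statement and proof as the door of record `lastResponse_bracket_flow_final_sqrt` (p637552) EXCEPT the two order-`s` alias-tail envelopes, which are now
GRADED like the orders `j ≤ 4`: `hNsb : Msb ≤ Nsb·((4:ℝ)^{n_β})^s`, `hNsc : Msc ≤ Nsc·((4:ℝ)^{n_β})^s` (was `Msb ≤ Nsb`, `Msc ≤ Nsc`), and the two alias-tail
coefficients in the smallness row `hCU` read `Ns_X/2^282` (was `Ns_X/2^217`).  WHY (KL STATUS 2026-08-28 15:26Z): `Ms_X = Σ_x (1+|x̃₀|+|x̃₁|)^s‖𝔉⁻¹[datum](x)‖`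
is a plain lattice moment of a scale-`N+1` two-leg datum (`N = n_β`) whose position kernel has range `Λ_N⁻¹ = 32·4^N ≍ β/π`, so its natural size is
`≍ C_s·(32·4^N)^s × (order-0 mass)` and no β-uniform envelope exists for the natural supplier; with the graded envelope the far part keeps
`(4^N·4/L)^{s−10} ≤ 1` (volume door `klEngL₄ ≤ L`) and pays `(4^N)^{10} ≤ β^{10}/2^{65}` out of the `β^{12}` of `(U/(2^59β³))⁴`
(`…LastStepAliasRowsGradedS.lastAliasRowB_le_graded`).  `Nsb`, `Nsc` are now β-free graded coefficients (natural size `≍ U·C_s·32^s`, resp. `U²`-class for `c`).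
WHAT THE DOOR READS (34 hypotheses, as before): regime `hR hc hcle hU hU1 hUle hβmin hβc hμ hK`; engine history + closed envelopes `hGS hQS hR0 hPh hT hW hΞ hΘ hdoor`;
`hL : klEngL₄ P R β U ≤ L`; analyticity `hZn`; the smallness rows `hZtU hCU`; `hs : 10 ≤ s`; the four moment data `hMm_b hMs_b hMm_c hMs_c`, size rows `hZb hZc`,
graded envelopes `hNm_X hNs_X`.  Output = `(hRdiff, hR)` of `twoLegReadPriv_flow_succ_of_swap_lit` (k3c3-p1, p606560) at `n = n_β`.

* **`lastResponse_bracket_flow_final_graded`**.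

Composition only; no definitions; nothing asserts superconductivity.  Refs: BGM 2006 §2.2 (2.23), §2.3 (2.21)–(2.24), §2.4 Lemma 2.1 (2.36)–(2.42), §3 (3.2)
[cite: BenfattoGiulianiMastropietro2006]; FST 1996 §1 [cite: FeldmanSalmhoferTrubowitz1996].
-/

noncomputable section

namespace Summit.HubbardSuperconductivity.HubbardSuperconductivity.Theorems.EngineV8

set_option linter.dupNamespace false -- summit = problem name (single-conjunct summit), D-0017
set_option exponentiation.threshold 512 -- the graded alias-tail constant is `2^282`

open Complex Real Finset Filter Literature.MathematicalPhysics.QuantumLattice Literature.Probability.LatticeModels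
open Literature.MathematicalPhysics.QuantumLattice.BandSectorCounting
open Literature.Analysis.Fourier Literature.Analysis.Calculus
open Summit.HubbardSuperconductivity.HubbardSuperconductivity.Theorems.KLRegimeSplit
open Summit.HubbardSuperconductivity.HubbardSuperconductivity.Theorems.DispersionFlow
open Summit.HubbardSuperconductivity.HubbardSuperconductivity.Theorems.KLProgrammeLegKernels
open Summit.HubbardSuperconductivity.HubbardSuperconductivity.Theorems.PerturbedFermiCurve
open scoped Nat

section FlowFinalGraded

variable {L M : ℕ} [NeZero L] [NeZero M]

set_option maxHeartbeats 400000 in -- heartbeat disclosure (R137): ≈ 90-binder statement + one 70-argument composition with eight explicit function instantiations (same class as `…FlowSharpAlias`: 200k whnf-times-out)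
/-- **THE #20 (δ′) DOOR WITH GRADED ORDER-`s` ENVELOPES** — see the module docstring.  Output = `(hRdiff, hR)` of `twoLegReadPriv_flow_succ_of_swap_lit`
at `n = nScales β` with `eR = fun k => if k = 0 then 0 else 1`, `eR' = fun k => if k = 0 then 1 else 0`. -/
theorem lastResponse_bracket_flow_final_graded {R : RenConsts} (hR : ∀ j, 0 ≤ R.Gfr j) {c : ℝ} (hc : 0 < c) (hcle : c ≤ klCurveC3 R)
    {U : ℝ} (hU : 0 < U) (hU1 : U ≤ 1) (hUle : U ≤ klCurveU0 R) {β : ℝ} (hβmin : klBetaMin ≤ β) (hβc : β ≤ Real.exp (c / U ^ 2))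
    {μ : ℝ} (hμ : μ ∈ klWindowC) (hK : FrameOK R U (nScales β) μ (klFlowFrameU L M β U μ (nScales β))) {G : GeoConsts} {Q : EngConsts} (hGS : ∀ k, 0 ≤ G.S k) (hQS : ∀ k, 0 ≤ Q.S' k) (hR0 : 0 < R.Gfr 0)
    (hPh : ∀ m ≤ nScales β, FlowPieceJetsAt L M β U μ R m) (hT : ∀ m ≤ nScales β, TwoLegReadJetsF L M G Q β U μ m) {W Ξ Θ : ℝ}
    (hW : W = curveExtC (klChi2CauchyTab2 4) G.S 1 + curveExtC (klChi2CauchyTab2 4) Q.S' 1 * |U|) (hΞ : Ξ = 2 ^ 10 * (1 + Real.pi ^ 8 * (W * U ^ 2) / 2 ^ 11) + ∑ j ∈ range 5, R.Gfr j)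
    (hΘ : Θ = 1 + ((∑ j ∈ range 5, R.Gfr j) + Real.pi ^ 8 * W / 2 ^ 11) * |U| / R.Gfr 0)
    (hdoor : R.Gfr 0 * |U| + ((∑ j ∈ range 5, R.Gfr j) + Real.pi ^ 8 * W / 2 ^ 11) * U ^ 2 ≤ 1 / 512) {P : SplitConsts} (hL : klEngL₄ P R β U ≤ L)
    (hZn : IsUnit (effPartitionFn ℂ (normalCovariance L M (uvSymbolCT L M β μ (klFlowFrameU L M β U μ (nScales β + 1)) (klScale klE0 (nScales β + 1))))
      (hubbardInteraction L M β U + counterQuadratic L M β (klFlowFrameU L M β U μ (nScales β + 1)))))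
    {Zb Zc Nmb Nsb Nmc Nsc : ℝ} (hZtU : 2 * (128 * (R.Gfr 0 + R.Gfr 1 + R.Gfr 2 + R.Gfr 3 + R.Gfr 4) * (1696963596321 + 925 * (10 ^ 14 * (1 + R.Gfr 3 + R.Gfr 4)))) * U ≤ 1)
    (hCU : 16 * (2 ^ 29 * (1 / 32) * (128 * (R.Gfr 0 + R.Gfr 1 + R.Gfr 2 + R.Gfr 3 + R.Gfr 4) * (1696963596321 + 925 * (10 ^ 14 * (1 + R.Gfr 3 + R.Gfr 4)))) ^ 3 * (1696963596321 +
      925 * (10 ^ 14 * (1 + R.Gfr 3 + R.Gfr 4))) + 2 ^ 38 * (128 * (R.Gfr 0 + R.Gfr 1 + R.Gfr 2 + R.Gfr 3 + R.Gfr 4) * (1696963596321 + 925 * (10 ^ 14 * (1 + R.Gfr 3 + R.Gfr 4)))) ^ 2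
      * Zb + 2 ^ 33 * (128 * (R.Gfr 0 + R.Gfr 1 + R.Gfr 2 + R.Gfr 3 + R.Gfr 4) * (1696963596321 + 925 * (10 ^ 14 * (1 + R.Gfr 3 + R.Gfr 4)))) * Zc + (klEngRsq R ^ 4 * (1696963596321 +
      925 * (10 ^ 14 * (1 + R.Gfr 3 + R.Gfr 4))) / 2 ^ 30 + (Nmb * klEngRsq R ^ 4 / 2 ^ 6 + Nsb / 2 ^ 282) * (1696963596321 + 925 * (10 ^ 14 * (1 + R.Gfr 3 + R.Gfr 4))) / 2 ^ 13 + (Nmc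
      * klEngRsq R ^ 4 / 2 ^ 6 + Nsc / 2 ^ 282) * (1696963596321 + 925 * (10 ^ 14 * (1 + R.Gfr 3 + R.Gfr 4))) / 2 ^ 13)) * U ≤ 1)
    {s : ℕ} (hs : 10 ≤ s)
    {Mmb : ℕ → ℝ} (hMmb : ∀ m ≤ 4, ∑ x : TorusSite 2 L, (1 + ((x 0).valMinAbs.natAbs : ℝ) + ((x 1).valMinAbs.natAbs : ℝ)) ^ m *
      ‖torusFourierInv (fun k => ((((fun k : TorusSite 2 L => klLocSelfEnergyRe L M β U μ (klFlowFrameU L M β U μ (nScales β + 1)) (nScales β + 1) k) k : ℝ)) : ℂ)) x‖ ≤ Mmb m)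
    {Msb : ℝ} (hMsb : ∑ x : TorusSite 2 L, (1 + ((x 0).valMinAbs.natAbs : ℝ) + ((x 1).valMinAbs.natAbs : ℝ)) ^ s *
      ‖torusFourierInv (fun k => ((((fun k : TorusSite 2 L => klLocSelfEnergyRe L M β U μ (klFlowFrameU L M β U μ (nScales β + 1)) (nScales β + 1) k) k : ℝ)) : ℂ)) x‖ ≤ Msb)
    {Mmc : ℕ → ℝ} (hMmc : ∀ m ≤ 4, ∑ x : TorusSite 2 L, (1 + ((x 0).valMinAbs.natAbs : ℝ) + ((x 1).valMinAbs.natAbs : ℝ)) ^ m *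
      ‖torusFourierInv (fun k => ((((fun k : TorusSite 2 L => (∑ s : Fin 2, ((klSelfEnergy L M β U μ (klFlowFrameU L M β U μ (nScales β + 1)) klE0 (nScales β + 1) (omega0 M, k) s).im -
          (klSelfEnergy L M β U μ (klFlowFrameU L M β U μ (nScales β + 1)) klE0 (nScales β + 1) ((omega0 M).rev, k) s).im)) / 4) k : ℝ)) : ℂ)) x‖ ≤ Mmc m)
    {Msc : ℝ} (hMsc : ∑ x : TorusSite 2 L, (1 + ((x 0).valMinAbs.natAbs : ℝ) + ((x 1).valMinAbs.natAbs : ℝ)) ^ s *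
      ‖torusFourierInv (fun k => ((((fun k : TorusSite 2 L => (∑ s : Fin 2, ((klSelfEnergy L M β U μ (klFlowFrameU L M β U μ (nScales β + 1)) klE0 (nScales β + 1) (omega0 M, k) s).im -
          (klSelfEnergy L M β U μ (klFlowFrameU L M β U μ (nScales β + 1)) klE0 (nScales β + 1) ((omega0 M).rev, k) s).im)) / 4) k : ℝ)) : ℂ)) x‖ ≤ Msc)
    (hZb : Nmb * (1696963596321 + 925 * (10 ^ 14 * (1 + R.Gfr 3 + R.Gfr 4))) ≤ Zb * U) (hZc : Nmc * (1696963596321 + 925 * (10 ^ 14 * (1 + R.Gfr 3 + R.Gfr 4))) * (4 : ℝ) ^ nScales β ≤ Zc * U ^ 2)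
    (hNmb : ∀ j ≤ 4, Mmb j ≤ Nmb * ((4 : ℝ) ^ nScales β) ^ j) (hNsb : Msb ≤ Nsb * ((4 : ℝ) ^ nScales β) ^ s) (hNmc : ∀ j ≤ 4, Mmc j ≤ Nmc * ((4 : ℝ) ^ nScales β) ^ j) (hNsc : Msc ≤ Nsc * ((4 : ℝ) ^ nScales β) ^ s) :
    ContDiff ℝ 4 (fun θ : ℝ => (symInterp L (fun k => klLocSelfEnergyRe L M β U μ (klFlowFrameU L M β U μ (nScales β + 1)) (nScales β + 1) k -
            (klFlowFrameU L M β U μ (nScales β + 1)).eval (latticeMomentum L k))).eval (klFermiPoint μ (klFlowFrameU L M β U μ (nScales β)) θ) -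
        (symInterp L (fun k => klLocSelfEnergyRe L M β U μ (klFlowFrameU L M β U μ (nScales β)) (nScales β + 1) k -
            (klFlowFrameU L M β U μ (nScales β)).eval (latticeMomentum L k))).eval (klFermiPoint μ (klFlowFrameU L M β U μ (nScales β)) θ)) ∧
    ∀ k ≤ 4, ∀ θ : ℝ, |iteratedDeriv k (fun θ : ℝ => (symInterp L (fun k => klLocSelfEnergyRe L M β U μ (klFlowFrameU L M β U μ (nScales β + 1)) (nScales β + 1) k -
            (klFlowFrameU L M β U μ (nScales β + 1)).eval (latticeMomentum L k))).eval (klFermiPoint μ (klFlowFrameU L M β U μ (nScales β)) θ) -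
        (symInterp L (fun k => klLocSelfEnergyRe L M β U μ (klFlowFrameU L M β U μ (nScales β)) (nScales β + 1) k -
            (klFlowFrameU L M β U μ (nScales β)).eval (latticeMomentum L k))).eval (klFermiPoint μ (klFlowFrameU L M β U μ (nScales β)) θ)) θ| ≤
      curveJetBar (fun k => if k = 0 then 0 else 1) (fun k => if k = 0 then 1 else 0) U k (nScales β + 1) := by
  have h128 : (128 : ℝ) ≤ β := by simpa [klBetaMin] using hβmin
  have hβ0 : (0 : ℝ) < β := by linarith
  have hX40 : (0 : ℝ) ≤ klChi2CauchyTab2 4 := by norm_num [klChi2CauchyTab2]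
  have hW0 : 0 ≤ W := by
    rw [hW]; have h1 := curveExtC_nonneg hX40 hGS 1; have h2 := curveExtC_nonneg hX40 hQS 1; positivity
  have hl1 : (1 : ℝ) ≤ ((4 : ℝ) ^ nScales β) := one_le_pow₀ (by norm_num)
  have hl0 : (0 : ℝ) < ((4 : ℝ) ^ nScales β) := by positivity
  have hRsq0 : (0 : ℝ) ≤ klEngRsq R := (klEngRsq_pos R).le
  have hS8 : (0 : ℝ) ≤ Real.sqrt (klEngRsq R) ^ 8 := pow_nonneg (Real.sqrt_nonneg _) 8
  have e8 : Real.sqrt (klEngRsq R) ^ 8 = klEngRsq R ^ 4 := by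
    rw [show (8 : ℕ) = 2 * 4 by norm_num, pow_mul, Real.sq_sqrt hRsq0]
  have hV0 : (0 : ℝ) ≤ (U ^ 3 / β ^ 2) := div_nonneg (pow_nonneg hU.le 3) (sq_nonneg β)
  -- the moments are nonnegative; so are the envelopes
  have hMmb0 : ∀ m ≤ 4, 0 ≤ Mmb m := fun m hm => le_trans (Finset.sum_nonneg fun x _ => by positivity) (hMmb m hm)
  have hMsb0 : 0 ≤ Msb := le_trans (Finset.sum_nonneg fun x _ => by positivity) hMsb
  have hMmc0 : ∀ m ≤ 4, 0 ≤ Mmc m := fun m hm => le_trans (Finset.sum_nonneg fun x _ => by positivity) (hMmc m hm)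
  have hMsc0 : 0 ≤ Msc := le_trans (Finset.sum_nonneg fun x _ => by positivity) hMsc
  have hNmb0 : 0 ≤ Nmb := by have h := hNmb 0 (by norm_num); rw [pow_zero, mul_one] at h; exact (hMmb0 0 (by norm_num)).trans h
  have hNmc0 : 0 ≤ Nmc := by have h := hNmc 0 (by norm_num); rw [pow_zero, mul_one] at h; exact (hMmc0 0 (by norm_num)).trans h
  have hNsb0 : 0 ≤ Nsb := nonneg_of_le_mul_pow hMsb0 hl1 hNsb
  have hNsc0 : 0 ≤ Nsc := nonneg_of_le_mul_pow hMsc0 hl1 hNsc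
  have hcA0 : (0 : ℝ) ≤ Real.sqrt (klEngRsq R) ^ 8 / 2 ^ 17 * (U ^ 3 / β ^ 2) := mul_nonneg (div_nonneg hS8 (by norm_num)) hV0
  have hcB0 : (0 : ℝ) ≤ (Nmb * Real.sqrt (klEngRsq R) ^ 8 / 2 ^ 6 + Nsb / 2 ^ 282) * (U ^ 3 / β ^ 2) := mul_nonneg (add_nonneg (div_nonneg (mul_nonneg hNmb0 hS8) (by norm_num)) (div_nonneg hNsb0 (by norm_num))) hV0
  have hcC0 : (0 : ℝ) ≤ (Nmc * Real.sqrt (klEngRsq R) ^ 8 / 2 ^ 6 + Nsc / 2 ^ 282) * (U ^ 3 / β ^ 2) := mul_nonneg (add_nonneg (div_nonneg (mul_nonneg hNmc0 hS8) (by norm_num)) (div_nonneg hNsc0 (by norm_num))) hV0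
  have cAconv : Real.sqrt (klEngRsq R) ^ 8 * U ^ 3 / (2 ^ 17 * β ^ 2) = Real.sqrt (klEngRsq R) ^ 8 / 2 ^ 17 * (U ^ 3 / β ^ 2) := by
    rw [div_mul_div_comm]
  -- the graded rows of the three channels (…LastStepAliasRowsSqrt + graded envelopes)
  have rowA : ∀ j ≤ 4, 2 * (2 * (1 * ((3 : ℝ) ^ j * (((R.Gfr 0 * |U| * Θ * ((16 : ℝ) ^ nScales β)⁻¹) * (R.Gfr 0 * |U| * Θ * ((16 : ℝ) ^ nScales β)⁻¹) / |(β * (L : ℝ) ^ 2)|) * ((5 : ℝ) * (|(β * (L : ℝ)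
      ^ 2)| * (6 / (klScale klE0 (nScales β + 1))))) * ((26 ! : ℝ)) ^ 2 * (2 * (2 * (2 ^ 10 * (1 : ℝ) * (4 : ℝ) ^ nScales β) + 2 * (4 * (2 * (4 * (4 + (4 : ℝ) ^ nScales β * Ξ) * (1 +
      16 * (1 + (27 / 10 : ℝ)) / (klScale klE0 (nScales β + 1)) * 1) + (2 ^ 10 * (1 : ℝ) * (4 : ℝ) ^ nScales β))) * (1 + 6 / (klScale klE0 (nScales β + 1)) * ((klScale klE0 (nScales β
      + 1)) / 128 + (5 : ℝ) * (R.Gfr 0 * |U| * Θ * ((16 : ℝ) ^ nScales β)⁻¹)))))) ^ 26) * (2 / ((2 * (L / 4 + 1) : ℕ) : ℝ)) ^ (26 - j - 4) * (2 ^ 2 * ∑' k : Fin 2 → ℤ, ∏ i, (1 + (k i :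
      ℝ) ^ 2)⁻¹)))) + (L : ℝ) ^ 2 * (L : ℝ) ^ j * ((((R.Gfr 0 * |U| * Θ * ((16 : ℝ) ^ nScales β)⁻¹) * (R.Gfr 0 * |U| * Θ * ((16 : ℝ) ^ nScales β)⁻¹) / |(β * (L : ℝ) ^ 2)|) * ((5 : ℝ) *
      (|(β * (L : ℝ) ^ 2)| * (6 / (klScale klE0 (nScales β + 1))))) * ((0 ! : ℝ)) ^ 2 * (2 * (2 * (2 ^ 10 * (1 : ℝ) * (4 : ℝ) ^ nScales β) + 2 * (4 * (2 * (4 * (4 + (4 : ℝ) ^ nScales β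
      * Ξ) * (1 + 16 * (1 + (27 / 10 : ℝ)) / (klScale klE0 (nScales β + 1)) * 1) + (2 ^ 10 * (1 : ℝ) * (4 : ℝ) ^ nScales β))) * (1 + 6 / (klScale klE0 (nScales β + 1)) * ((klScale klE0
      (nScales β + 1)) / 128 + (5 : ℝ) * (R.Gfr 0 * |U| * Θ * ((16 : ℝ) ^ nScales β)⁻¹)))))) ^ 0) * (1 / (1 + (L : ℝ) / 4) ^ s)) ≤ Real.sqrt (klEngRsq R) ^ 8 / 2 ^ 17 * (U ^ 3 / β ^ 2) * ((4 : ℝ) ^ nScales β) ^ j := fun j hj => by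
    have h := lastAliasRowA_le_sqrt (P := P) hR hR0 hW0 hβmin hU hU1 hΞ hΘ hdoor hL hs hj
    rw [cAconv] at h
    exact h.trans (le_mul_of_one_le_right hcA0 (one_le_pow₀ hl1))
  have rowA0 : ∀ j ≤ 4, 0 ≤ 2 * (2 * (1 * ((3 : ℝ) ^ j * (((R.Gfr 0 * |U| * Θ * ((16 : ℝ) ^ nScales β)⁻¹) * (R.Gfr 0 * |U| * Θ * ((16 : ℝ) ^ nScales β)⁻¹) / |(β * (L : ℝ) ^ 2)|) * ((5 : ℝ) * (|(β * (L : ℝ)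
      ^ 2)| * (6 / (klScale klE0 (nScales β + 1))))) * ((26 ! : ℝ)) ^ 2 * (2 * (2 * (2 ^ 10 * (1 : ℝ) * (4 : ℝ) ^ nScales β) + 2 * (4 * (2 * (4 * (4 + (4 : ℝ) ^ nScales β * Ξ) * (1 +
      16 * (1 + (27 / 10 : ℝ)) / (klScale klE0 (nScales β + 1)) * 1) + (2 ^ 10 * (1 : ℝ) * (4 : ℝ) ^ nScales β))) * (1 + 6 / (klScale klE0 (nScales β + 1)) * ((klScale klE0 (nScales β
      + 1)) / 128 + (5 : ℝ) * (R.Gfr 0 * |U| * Θ * ((16 : ℝ) ^ nScales β)⁻¹)))))) ^ 26) * (2 / ((2 * (L / 4 + 1) : ℕ) : ℝ)) ^ (26 - j - 4) * (2 ^ 2 * ∑' k : Fin 2 → ℤ, ∏ i, (1 + (k i :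
      ℝ) ^ 2)⁻¹)))) + (L : ℝ) ^ 2 * (L : ℝ) ^ j * ((((R.Gfr 0 * |U| * Θ * ((16 : ℝ) ^ nScales β)⁻¹) * (R.Gfr 0 * |U| * Θ * ((16 : ℝ) ^ nScales β)⁻¹) / |(β * (L : ℝ) ^ 2)|) * ((5 : ℝ) *
      (|(β * (L : ℝ) ^ 2)| * (6 / (klScale klE0 (nScales β + 1))))) * ((0 ! : ℝ)) ^ 2 * (2 * (2 * (2 ^ 10 * (1 : ℝ) * (4 : ℝ) ^ nScales β) + 2 * (4 * (2 * (4 * (4 + (4 : ℝ) ^ nScales β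
      * Ξ) * (1 + 16 * (1 + (27 / 10 : ℝ)) / (klScale klE0 (nScales β + 1)) * 1) + (2 ^ 10 * (1 : ℝ) * (4 : ℝ) ^ nScales β))) * (1 + 6 / (klScale klE0 (nScales β + 1)) * ((klScale klE0
      (nScales β + 1)) / 128 + (5 : ℝ) * (R.Gfr 0 * |U| * Θ * ((16 : ℝ) ^ nScales β)⁻¹)))))) ^ 0) * (1 / (1 + (L : ℝ) / 4) ^ s)) := fun j _ =>
    lastAliasRowA_nonneg hR hR0 hW0 hβmin hΞ hΘ hdoor (s := s) (j := j)
  have rowB : ∀ j ≤ 4, 2 * (2 * (Mmb j * ((3 : ℝ) ^ j * (((R.Gfr 0 * |U| * Θ * ((16 : ℝ) ^ nScales β)⁻¹) / |(β * (L : ℝ) ^ 2)| * ((5 : ℝ) * (|(β * (L : ℝ) ^ 2)| * (6 / (klScale klE0 (nScales β +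
      1)))))) * ((R.Gfr 0 * |U| * Θ * ((16 : ℝ) ^ nScales β)⁻¹) / |(β * (L : ℝ) ^ 2)| * ((5 : ℝ) * (|(β * (L : ℝ) ^ 2)| * (6 / (klScale klE0 (nScales β + 1)))))) * ((26 ! : ℝ)) ^ 2 *
      (2 * (2 * (2 * (2 ^ 10 * (1 : ℝ) * (4 : ℝ) ^ nScales β) + 2 * (4 * (2 * (4 * (4 + (4 : ℝ) ^ nScales β * Ξ) * (1 + 16 * (1 + (27 / 10 : ℝ)) / (klScale klE0 (nScales β + 1)) * 1) +
      (2 ^ 10 * (1 : ℝ) * (4 : ℝ) ^ nScales β))) * (1 + 6 / (klScale klE0 (nScales β + 1)) * ((klScale klE0 (nScales β + 1)) / 128 + (5 : ℝ) * (R.Gfr 0 * |U| * Θ * ((16 : ℝ) ^ nScales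
      β)⁻¹))))))) ^ 26 + 2 * (((R.Gfr 0 * |U| * Θ * ((16 : ℝ) ^ nScales β)⁻¹) / |(β * (L : ℝ) ^ 2)|) * ((5 : ℝ) * (|(β * (L : ℝ) ^ 2)| * (6 / (klScale klE0 (nScales β + 1))))) * ((26 !
      : ℝ)) ^ 2 * (2 * (2 * (2 ^ 10 * (1 : ℝ) * (4 : ℝ) ^ nScales β) + 2 * (4 * (2 * (4 * (4 + (4 : ℝ) ^ nScales β * Ξ) * (1 + 16 * (1 + (27 / 10 : ℝ)) / (klScale klE0 (nScales β + 1))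
      * 1) + (2 ^ 10 * (1 : ℝ) * (4 : ℝ) ^ nScales β))) * (1 + 6 / (klScale klE0 (nScales β + 1)) * ((klScale klE0 (nScales β + 1)) / 128 + (5 : ℝ) * (R.Gfr 0 * |U| * Θ * ((16 : ℝ) ^
      nScales β)⁻¹)))))) ^ 26)) * (2 / ((2 * (L / 4 + 1) : ℕ) : ℝ)) ^ (26 - j - 4) * (2 ^ 2 * ∑' k : Fin 2 → ℤ, ∏ i, (1 + (k i : ℝ) ^ 2)⁻¹)))) + (L : ℝ) ^ 2 * (L : ℝ) ^ j * ((((R.Gfr 0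
      * |U| * Θ * ((16 : ℝ) ^ nScales β)⁻¹) / |(β * (L : ℝ) ^ 2)| * ((5 : ℝ) * (|(β * (L : ℝ) ^ 2)| * (6 / (klScale klE0 (nScales β + 1)))))) * ((R.Gfr 0 * |U| * Θ * ((16 : ℝ) ^
      nScales β)⁻¹) / |(β * (L : ℝ) ^ 2)| * ((5 : ℝ) * (|(β * (L : ℝ) ^ 2)| * (6 / (klScale klE0 (nScales β + 1)))))) * ((0 ! : ℝ)) ^ 2 * (2 * (2 * (2 * (2 ^ 10 * (1 : ℝ) * (4 : ℝ) ^
      nScales β) + 2 * (4 * (2 * (4 * (4 + (4 : ℝ) ^ nScales β * Ξ) * (1 + 16 * (1 + (27 / 10 : ℝ)) / (klScale klE0 (nScales β + 1)) * 1) + (2 ^ 10 * (1 : ℝ) * (4 : ℝ) ^ nScales β))) *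
      (1 + 6 / (klScale klE0 (nScales β + 1)) * ((klScale klE0 (nScales β + 1)) / 128 + (5 : ℝ) * (R.Gfr 0 * |U| * Θ * ((16 : ℝ) ^ nScales β)⁻¹))))))) ^ 0 + 2 * (((R.Gfr 0 * |U| * Θ *
      ((16 : ℝ) ^ nScales β)⁻¹) / |(β * (L : ℝ) ^ 2)|) * ((5 : ℝ) * (|(β * (L : ℝ) ^ 2)| * (6 / (klScale klE0 (nScales β + 1))))) * ((0 ! : ℝ)) ^ 2 * (2 * (2 * (2 ^ 10 * (1 : ℝ) * (4 :
      ℝ) ^ nScales β) + 2 * (4 * (2 * (4 * (4 + (4 : ℝ) ^ nScales β * Ξ) * (1 + 16 * (1 + (27 / 10 : ℝ)) / (klScale klE0 (nScales β + 1)) * 1) + (2 ^ 10 * (1 : ℝ) * (4 : ℝ) ^ nScales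
      β))) * (1 + 6 / (klScale klE0 (nScales β + 1)) * ((klScale klE0 (nScales β + 1)) / 128 + (5 : ℝ) * (R.Gfr 0 * |U| * Θ * ((16 : ℝ) ^ nScales β)⁻¹)))))) ^ 0)) * (Msb / (1 + (L : ℝ)
      / 4) ^ s)) ≤ (Nmb * Real.sqrt (klEngRsq R) ^ 8 / 2 ^ 6 + Nsb / 2 ^ 282) * (U ^ 3 / β ^ 2) * ((4 : ℝ) ^ nScales β) ^ j := fun j hj =>
    (lastAliasRowB_le_graded (P := P) hR hR0 hW0 hβmin hU hU1 hΞ hΘ hdoor hL hs hj (hMmb0 j hj) hMsb0 hNsb).trans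
      (graded_envelope_le_graded hU.le hU1 h128 hl1 (hMmb0 j hj) hNsb0 (hNmb j hj))
  have rowB0 : ∀ j ≤ 4, 0 ≤ 2 * (2 * (Mmb j * ((3 : ℝ) ^ j * (((R.Gfr 0 * |U| * Θ * ((16 : ℝ) ^ nScales β)⁻¹) / |(β * (L : ℝ) ^ 2)| * ((5 : ℝ) * (|(β * (L : ℝ) ^ 2)| * (6 / (klScale klE0 (nScales β +
      1)))))) * ((R.Gfr 0 * |U| * Θ * ((16 : ℝ) ^ nScales β)⁻¹) / |(β * (L : ℝ) ^ 2)| * ((5 : ℝ) * (|(β * (L : ℝ) ^ 2)| * (6 / (klScale klE0 (nScales β + 1)))))) * ((26 ! : ℝ)) ^ 2 *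
      (2 * (2 * (2 * (2 ^ 10 * (1 : ℝ) * (4 : ℝ) ^ nScales β) + 2 * (4 * (2 * (4 * (4 + (4 : ℝ) ^ nScales β * Ξ) * (1 + 16 * (1 + (27 / 10 : ℝ)) / (klScale klE0 (nScales β + 1)) * 1) +
      (2 ^ 10 * (1 : ℝ) * (4 : ℝ) ^ nScales β))) * (1 + 6 / (klScale klE0 (nScales β + 1)) * ((klScale klE0 (nScales β + 1)) / 128 + (5 : ℝ) * (R.Gfr 0 * |U| * Θ * ((16 : ℝ) ^ nScales
      β)⁻¹))))))) ^ 26 + 2 * (((R.Gfr 0 * |U| * Θ * ((16 : ℝ) ^ nScales β)⁻¹) / |(β * (L : ℝ) ^ 2)|) * ((5 : ℝ) * (|(β * (L : ℝ) ^ 2)| * (6 / (klScale klE0 (nScales β + 1))))) * ((26 !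
      : ℝ)) ^ 2 * (2 * (2 * (2 ^ 10 * (1 : ℝ) * (4 : ℝ) ^ nScales β) + 2 * (4 * (2 * (4 * (4 + (4 : ℝ) ^ nScales β * Ξ) * (1 + 16 * (1 + (27 / 10 : ℝ)) / (klScale klE0 (nScales β + 1))
      * 1) + (2 ^ 10 * (1 : ℝ) * (4 : ℝ) ^ nScales β))) * (1 + 6 / (klScale klE0 (nScales β + 1)) * ((klScale klE0 (nScales β + 1)) / 128 + (5 : ℝ) * (R.Gfr 0 * |U| * Θ * ((16 : ℝ) ^
      nScales β)⁻¹)))))) ^ 26)) * (2 / ((2 * (L / 4 + 1) : ℕ) : ℝ)) ^ (26 - j - 4) * (2 ^ 2 * ∑' k : Fin 2 → ℤ, ∏ i, (1 + (k i : ℝ) ^ 2)⁻¹)))) + (L : ℝ) ^ 2 * (L : ℝ) ^ j * ((((R.Gfr 0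
      * |U| * Θ * ((16 : ℝ) ^ nScales β)⁻¹) / |(β * (L : ℝ) ^ 2)| * ((5 : ℝ) * (|(β * (L : ℝ) ^ 2)| * (6 / (klScale klE0 (nScales β + 1)))))) * ((R.Gfr 0 * |U| * Θ * ((16 : ℝ) ^
      nScales β)⁻¹) / |(β * (L : ℝ) ^ 2)| * ((5 : ℝ) * (|(β * (L : ℝ) ^ 2)| * (6 / (klScale klE0 (nScales β + 1)))))) * ((0 ! : ℝ)) ^ 2 * (2 * (2 * (2 * (2 ^ 10 * (1 : ℝ) * (4 : ℝ) ^
      nScales β) + 2 * (4 * (2 * (4 * (4 + (4 : ℝ) ^ nScales β * Ξ) * (1 + 16 * (1 + (27 / 10 : ℝ)) / (klScale klE0 (nScales β + 1)) * 1) + (2 ^ 10 * (1 : ℝ) * (4 : ℝ) ^ nScales β))) *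
      (1 + 6 / (klScale klE0 (nScales β + 1)) * ((klScale klE0 (nScales β + 1)) / 128 + (5 : ℝ) * (R.Gfr 0 * |U| * Θ * ((16 : ℝ) ^ nScales β)⁻¹))))))) ^ 0 + 2 * (((R.Gfr 0 * |U| * Θ *
      ((16 : ℝ) ^ nScales β)⁻¹) / |(β * (L : ℝ) ^ 2)|) * ((5 : ℝ) * (|(β * (L : ℝ) ^ 2)| * (6 / (klScale klE0 (nScales β + 1))))) * ((0 ! : ℝ)) ^ 2 * (2 * (2 * (2 ^ 10 * (1 : ℝ) * (4 :
      ℝ) ^ nScales β) + 2 * (4 * (2 * (4 * (4 + (4 : ℝ) ^ nScales β * Ξ) * (1 + 16 * (1 + (27 / 10 : ℝ)) / (klScale klE0 (nScales β + 1)) * 1) + (2 ^ 10 * (1 : ℝ) * (4 : ℝ) ^ nScales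
      β))) * (1 + 6 / (klScale klE0 (nScales β + 1)) * ((klScale klE0 (nScales β + 1)) / 128 + (5 : ℝ) * (R.Gfr 0 * |U| * Θ * ((16 : ℝ) ^ nScales β)⁻¹)))))) ^ 0)) * (Msb / (1 + (L : ℝ)
      / 4) ^ s)) := fun j hj =>
    lastAliasRowB_nonneg hR hR0 hW0 hβmin hΞ hΘ hdoor (s := s) (j := j) (hMmb0 j hj) hMsb0
  have rowC : ∀ j ≤ 4, 2 * (2 * (Mmc j * ((3 : ℝ) ^ j * (((R.Gfr 0 * |U| * Θ * ((16 : ℝ) ^ nScales β)⁻¹) / |(β * (L : ℝ) ^ 2)| * ((5 : ℝ) * (|(β * (L : ℝ) ^ 2)| * (6 / (klScale klE0 (nScales β +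
      1)))))) * ((R.Gfr 0 * |U| * Θ * ((16 : ℝ) ^ nScales β)⁻¹) / |(β * (L : ℝ) ^ 2)| * ((5 : ℝ) * (|(β * (L : ℝ) ^ 2)| * (6 / (klScale klE0 (nScales β + 1)))))) * ((26 ! : ℝ)) ^ 2 *
      (2 * (2 * (2 * (2 ^ 10 * (1 : ℝ) * (4 : ℝ) ^ nScales β) + 2 * (4 * (2 * (4 * (4 + (4 : ℝ) ^ nScales β * Ξ) * (1 + 16 * (1 + (27 / 10 : ℝ)) / (klScale klE0 (nScales β + 1)) * 1) +
      (2 ^ 10 * (1 : ℝ) * (4 : ℝ) ^ nScales β))) * (1 + 6 / (klScale klE0 (nScales β + 1)) * ((klScale klE0 (nScales β + 1)) / 128 + (5 : ℝ) * (R.Gfr 0 * |U| * Θ * ((16 : ℝ) ^ nScales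
      β)⁻¹))))))) ^ 26 + 2 * (((R.Gfr 0 * |U| * Θ * ((16 : ℝ) ^ nScales β)⁻¹) / |(β * (L : ℝ) ^ 2)|) * ((5 : ℝ) * (|(β * (L : ℝ) ^ 2)| * (6 / (klScale klE0 (nScales β + 1))))) * ((26 !
      : ℝ)) ^ 2 * (2 * (2 * (2 ^ 10 * (1 : ℝ) * (4 : ℝ) ^ nScales β) + 2 * (4 * (2 * (4 * (4 + (4 : ℝ) ^ nScales β * Ξ) * (1 + 16 * (1 + (27 / 10 : ℝ)) / (klScale klE0 (nScales β + 1))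
      * 1) + (2 ^ 10 * (1 : ℝ) * (4 : ℝ) ^ nScales β))) * (1 + 6 / (klScale klE0 (nScales β + 1)) * ((klScale klE0 (nScales β + 1)) / 128 + (5 : ℝ) * (R.Gfr 0 * |U| * Θ * ((16 : ℝ) ^
      nScales β)⁻¹)))))) ^ 26)) * (2 / ((2 * (L / 4 + 1) : ℕ) : ℝ)) ^ (26 - j - 4) * (2 ^ 2 * ∑' k : Fin 2 → ℤ, ∏ i, (1 + (k i : ℝ) ^ 2)⁻¹)))) + (L : ℝ) ^ 2 * (L : ℝ) ^ j * ((((R.Gfr 0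
      * |U| * Θ * ((16 : ℝ) ^ nScales β)⁻¹) / |(β * (L : ℝ) ^ 2)| * ((5 : ℝ) * (|(β * (L : ℝ) ^ 2)| * (6 / (klScale klE0 (nScales β + 1)))))) * ((R.Gfr 0 * |U| * Θ * ((16 : ℝ) ^
      nScales β)⁻¹) / |(β * (L : ℝ) ^ 2)| * ((5 : ℝ) * (|(β * (L : ℝ) ^ 2)| * (6 / (klScale klE0 (nScales β + 1)))))) * ((0 ! : ℝ)) ^ 2 * (2 * (2 * (2 * (2 ^ 10 * (1 : ℝ) * (4 : ℝ) ^
      nScales β) + 2 * (4 * (2 * (4 * (4 + (4 : ℝ) ^ nScales β * Ξ) * (1 + 16 * (1 + (27 / 10 : ℝ)) / (klScale klE0 (nScales β + 1)) * 1) + (2 ^ 10 * (1 : ℝ) * (4 : ℝ) ^ nScales β))) *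
      (1 + 6 / (klScale klE0 (nScales β + 1)) * ((klScale klE0 (nScales β + 1)) / 128 + (5 : ℝ) * (R.Gfr 0 * |U| * Θ * ((16 : ℝ) ^ nScales β)⁻¹))))))) ^ 0 + 2 * (((R.Gfr 0 * |U| * Θ *
      ((16 : ℝ) ^ nScales β)⁻¹) / |(β * (L : ℝ) ^ 2)|) * ((5 : ℝ) * (|(β * (L : ℝ) ^ 2)| * (6 / (klScale klE0 (nScales β + 1))))) * ((0 ! : ℝ)) ^ 2 * (2 * (2 * (2 ^ 10 * (1 : ℝ) * (4 :
      ℝ) ^ nScales β) + 2 * (4 * (2 * (4 * (4 + (4 : ℝ) ^ nScales β * Ξ) * (1 + 16 * (1 + (27 / 10 : ℝ)) / (klScale klE0 (nScales β + 1)) * 1) + (2 ^ 10 * (1 : ℝ) * (4 : ℝ) ^ nScales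
      β))) * (1 + 6 / (klScale klE0 (nScales β + 1)) * ((klScale klE0 (nScales β + 1)) / 128 + (5 : ℝ) * (R.Gfr 0 * |U| * Θ * ((16 : ℝ) ^ nScales β)⁻¹)))))) ^ 0)) * (Msc / (1 + (L : ℝ)
      / 4) ^ s)) ≤ (Nmc * Real.sqrt (klEngRsq R) ^ 8 / 2 ^ 6 + Nsc / 2 ^ 282) * (U ^ 3 / β ^ 2) * ((4 : ℝ) ^ nScales β) ^ j := fun j hj =>
    (lastAliasRowB_le_graded (P := P) hR hR0 hW0 hβmin hU hU1 hΞ hΘ hdoor hL hs hj (hMmc0 j hj) hMsc0 hNsc).trans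
      (graded_envelope_le_graded hU.le hU1 h128 hl1 (hMmc0 j hj) hNsc0 (hNmc j hj))
  have rowC0 : ∀ j ≤ 4, 0 ≤ 2 * (2 * (Mmc j * ((3 : ℝ) ^ j * (((R.Gfr 0 * |U| * Θ * ((16 : ℝ) ^ nScales β)⁻¹) / |(β * (L : ℝ) ^ 2)| * ((5 : ℝ) * (|(β * (L : ℝ) ^ 2)| * (6 / (klScale klE0 (nScales β +
      1)))))) * ((R.Gfr 0 * |U| * Θ * ((16 : ℝ) ^ nScales β)⁻¹) / |(β * (L : ℝ) ^ 2)| * ((5 : ℝ) * (|(β * (L : ℝ) ^ 2)| * (6 / (klScale klE0 (nScales β + 1)))))) * ((26 ! : ℝ)) ^ 2 *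
      (2 * (2 * (2 * (2 ^ 10 * (1 : ℝ) * (4 : ℝ) ^ nScales β) + 2 * (4 * (2 * (4 * (4 + (4 : ℝ) ^ nScales β * Ξ) * (1 + 16 * (1 + (27 / 10 : ℝ)) / (klScale klE0 (nScales β + 1)) * 1) +
      (2 ^ 10 * (1 : ℝ) * (4 : ℝ) ^ nScales β))) * (1 + 6 / (klScale klE0 (nScales β + 1)) * ((klScale klE0 (nScales β + 1)) / 128 + (5 : ℝ) * (R.Gfr 0 * |U| * Θ * ((16 : ℝ) ^ nScales
      β)⁻¹))))))) ^ 26 + 2 * (((R.Gfr 0 * |U| * Θ * ((16 : ℝ) ^ nScales β)⁻¹) / |(β * (L : ℝ) ^ 2)|) * ((5 : ℝ) * (|(β * (L : ℝ) ^ 2)| * (6 / (klScale klE0 (nScales β + 1))))) * ((26 !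
      : ℝ)) ^ 2 * (2 * (2 * (2 ^ 10 * (1 : ℝ) * (4 : ℝ) ^ nScales β) + 2 * (4 * (2 * (4 * (4 + (4 : ℝ) ^ nScales β * Ξ) * (1 + 16 * (1 + (27 / 10 : ℝ)) / (klScale klE0 (nScales β + 1))
      * 1) + (2 ^ 10 * (1 : ℝ) * (4 : ℝ) ^ nScales β))) * (1 + 6 / (klScale klE0 (nScales β + 1)) * ((klScale klE0 (nScales β + 1)) / 128 + (5 : ℝ) * (R.Gfr 0 * |U| * Θ * ((16 : ℝ) ^
      nScales β)⁻¹)))))) ^ 26)) * (2 / ((2 * (L / 4 + 1) : ℕ) : ℝ)) ^ (26 - j - 4) * (2 ^ 2 * ∑' k : Fin 2 → ℤ, ∏ i, (1 + (k i : ℝ) ^ 2)⁻¹)))) + (L : ℝ) ^ 2 * (L : ℝ) ^ j * ((((R.Gfr 0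
      * |U| * Θ * ((16 : ℝ) ^ nScales β)⁻¹) / |(β * (L : ℝ) ^ 2)| * ((5 : ℝ) * (|(β * (L : ℝ) ^ 2)| * (6 / (klScale klE0 (nScales β + 1)))))) * ((R.Gfr 0 * |U| * Θ * ((16 : ℝ) ^
      nScales β)⁻¹) / |(β * (L : ℝ) ^ 2)| * ((5 : ℝ) * (|(β * (L : ℝ) ^ 2)| * (6 / (klScale klE0 (nScales β + 1)))))) * ((0 ! : ℝ)) ^ 2 * (2 * (2 * (2 * (2 ^ 10 * (1 : ℝ) * (4 : ℝ) ^
      nScales β) + 2 * (4 * (2 * (4 * (4 + (4 : ℝ) ^ nScales β * Ξ) * (1 + 16 * (1 + (27 / 10 : ℝ)) / (klScale klE0 (nScales β + 1)) * 1) + (2 ^ 10 * (1 : ℝ) * (4 : ℝ) ^ nScales β))) *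
      (1 + 6 / (klScale klE0 (nScales β + 1)) * ((klScale klE0 (nScales β + 1)) / 128 + (5 : ℝ) * (R.Gfr 0 * |U| * Θ * ((16 : ℝ) ^ nScales β)⁻¹))))))) ^ 0 + 2 * (((R.Gfr 0 * |U| * Θ *
      ((16 : ℝ) ^ nScales β)⁻¹) / |(β * (L : ℝ) ^ 2)|) * ((5 : ℝ) * (|(β * (L : ℝ) ^ 2)| * (6 / (klScale klE0 (nScales β + 1))))) * ((0 ! : ℝ)) ^ 2 * (2 * (2 * (2 ^ 10 * (1 : ℝ) * (4 :
      ℝ) ^ nScales β) + 2 * (4 * (2 * (4 * (4 + (4 : ℝ) ^ nScales β * Ξ) * (1 + 16 * (1 + (27 / 10 : ℝ)) / (klScale klE0 (nScales β + 1)) * 1) + (2 ^ 10 * (1 : ℝ) * (4 : ℝ) ^ nScales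
      β))) * (1 + 6 / (klScale klE0 (nScales β + 1)) * ((klScale klE0 (nScales β + 1)) / 128 + (5 : ℝ) * (R.Gfr 0 * |U| * Θ * ((16 : ℝ) ^ nScales β)⁻¹)))))) ^ 0)) * (Msc / (1 + (L : ℝ)
      / 4) ^ s)) := fun j hj =>
    lastAliasRowB_nonneg hR hR0 hW0 hβmin hΞ hΘ hdoor (s := s) (j := j) (hMmc0 j hj) hMsc0
  -- the curve table of the old flow frame, sharp
  obtain ⟨hD1, hDc1, hDc2, hDc3, hDc4⟩ := flowCurve_table_sharp hR hU.le hU1 (nScales β)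
  have hA₃0 : 0 ≤ (R.Gfr 3 * U ^ 2 * ((4 : ℝ) ^ (nScales β + 1) / 3)) := by have := hR 3; positivity
  have hA₄0 : 0 ≤ (R.Gfr 4 * U ^ 2 * ((16 : ℝ) ^ (nScales β + 1) / 15)) := by have := hR 4; positivity
  obtain ⟨n1, n2, n3, n4⟩ := klCurveD_sizes_nonneg hA₃0 hA₄0
  have hDc0 : ∀ i, 1 ≤ i → i ≤ 4 → 0 ≤ (fun i : ℕ => if i = 1 then klCurveD1 else if i = 2 then klCurveD2 else if i = 3 then klCurveD3 (R.Gfr 3 * U ^ 2 * ((4 : ℝ) ^ (nScales β + 1) / 3)) else klCurveD4 (R.Gfr 3 * U ^ 2 * ((4 : ℝ) ^ (nScales β + 1) / 3)) (R.Gfr 4 * U ^ 2 * ((16 : ℝ) ^ (nScales β + 1) / 15))) i := by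
    intro i hi1 hi4
    interval_cases i
    · exact n1
    · exact n2
    · exact n3
    · exact n4
  -- graded Bell rows: three alias channels and the two moment families
  obtain ⟨a0, a1, a2, a3, a4⟩ := bellRows_graded_le (f := fun j : ℕ => 2 * (2 * (1 * ((3 : ℝ) ^ j * (((R.Gfr 0 * |U| * Θ * ((16 : ℝ) ^ nScales β)⁻¹) * (R.Gfr 0 * |U| * Θ * ((16 : ℝ) ^ nScales β)⁻¹) / |(β * (L : ℝ) ^ 2)|) * ((5 : ℝ) * (|(β * (L : ℝ)
      ^ 2)| * (6 / (klScale klE0 (nScales β + 1))))) * ((26 ! : ℝ)) ^ 2 * (2 * (2 * (2 ^ 10 * (1 : ℝ) * (4 : ℝ) ^ nScales β) + 2 * (4 * (2 * (4 * (4 + (4 : ℝ) ^ nScales β * Ξ) * (1 +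
      16 * (1 + (27 / 10 : ℝ)) / (klScale klE0 (nScales β + 1)) * 1) + (2 ^ 10 * (1 : ℝ) * (4 : ℝ) ^ nScales β))) * (1 + 6 / (klScale klE0 (nScales β + 1)) * ((klScale klE0 (nScales β
      + 1)) / 128 + (5 : ℝ) * (R.Gfr 0 * |U| * Θ * ((16 : ℝ) ^ nScales β)⁻¹)))))) ^ 26) * (2 / ((2 * (L / 4 + 1) : ℕ) : ℝ)) ^ (26 - j - 4) * (2 ^ 2 * ∑' k : Fin 2 → ℤ, ∏ i, (1 + (k i :
      ℝ) ^ 2)⁻¹)))) + (L : ℝ) ^ 2 * (L : ℝ) ^ j * ((((R.Gfr 0 * |U| * Θ * ((16 : ℝ) ^ nScales β)⁻¹) * (R.Gfr 0 * |U| * Θ * ((16 : ℝ) ^ nScales β)⁻¹) / |(β * (L : ℝ) ^ 2)|) * ((5 : ℝ) *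
      (|(β * (L : ℝ) ^ 2)| * (6 / (klScale klE0 (nScales β + 1))))) * ((0 ! : ℝ)) ^ 2 * (2 * (2 * (2 ^ 10 * (1 : ℝ) * (4 : ℝ) ^ nScales β) + 2 * (4 * (2 * (4 * (4 + (4 : ℝ) ^ nScales β
      * Ξ) * (1 + 16 * (1 + (27 / 10 : ℝ)) / (klScale klE0 (nScales β + 1)) * 1) + (2 ^ 10 * (1 : ℝ) * (4 : ℝ) ^ nScales β))) * (1 + 6 / (klScale klE0 (nScales β + 1)) * ((klScale klE0
      (nScales β + 1)) / 128 + (5 : ℝ) * (R.Gfr 0 * |U| * Θ * ((16 : ℝ) ^ nScales β)⁻¹)))))) ^ 0) * (1 / (1 + (L : ℝ) / 4) ^ s)))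
    (Dc := (fun i : ℕ => if i = 1 then klCurveD1 else if i = 2 then klCurveD2 else if i = 3 then klCurveD3 (R.Gfr 3 * U ^ 2 * ((4 : ℝ) ^ (nScales β + 1) / 3)) else klCurveD4 (R.Gfr 3 * U ^ 2 * ((4 : ℝ) ^ (nScales β + 1) / 3)) (R.Gfr 4 * U ^ 2 * ((16 : ℝ) ^ (nScales β + 1) / 15)))) hl1 hcA0 hD1 rowA0 rowA hDc0 hDc1 hDc2 hDc3 hDc4
  obtain ⟨b0, b1, b2, b3, b4⟩ := bellRows_graded_le (f := fun j : ℕ => 2 * (2 * (Mmb j * ((3 : ℝ) ^ j * (((R.Gfr 0 * |U| * Θ * ((16 : ℝ) ^ nScales β)⁻¹) / |(β * (L : ℝ) ^ 2)| * ((5 : ℝ) * (|(β * (L : ℝ) ^ 2)| * (6 / (klScale klE0 (nScales β +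
      1)))))) * ((R.Gfr 0 * |U| * Θ * ((16 : ℝ) ^ nScales β)⁻¹) / |(β * (L : ℝ) ^ 2)| * ((5 : ℝ) * (|(β * (L : ℝ) ^ 2)| * (6 / (klScale klE0 (nScales β + 1)))))) * ((26 ! : ℝ)) ^ 2 *
      (2 * (2 * (2 * (2 ^ 10 * (1 : ℝ) * (4 : ℝ) ^ nScales β) + 2 * (4 * (2 * (4 * (4 + (4 : ℝ) ^ nScales β * Ξ) * (1 + 16 * (1 + (27 / 10 : ℝ)) / (klScale klE0 (nScales β + 1)) * 1) +
      (2 ^ 10 * (1 : ℝ) * (4 : ℝ) ^ nScales β))) * (1 + 6 / (klScale klE0 (nScales β + 1)) * ((klScale klE0 (nScales β + 1)) / 128 + (5 : ℝ) * (R.Gfr 0 * |U| * Θ * ((16 : ℝ) ^ nScales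
      β)⁻¹))))))) ^ 26 + 2 * (((R.Gfr 0 * |U| * Θ * ((16 : ℝ) ^ nScales β)⁻¹) / |(β * (L : ℝ) ^ 2)|) * ((5 : ℝ) * (|(β * (L : ℝ) ^ 2)| * (6 / (klScale klE0 (nScales β + 1))))) * ((26 !
      : ℝ)) ^ 2 * (2 * (2 * (2 ^ 10 * (1 : ℝ) * (4 : ℝ) ^ nScales β) + 2 * (4 * (2 * (4 * (4 + (4 : ℝ) ^ nScales β * Ξ) * (1 + 16 * (1 + (27 / 10 : ℝ)) / (klScale klE0 (nScales β + 1))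
      * 1) + (2 ^ 10 * (1 : ℝ) * (4 : ℝ) ^ nScales β))) * (1 + 6 / (klScale klE0 (nScales β + 1)) * ((klScale klE0 (nScales β + 1)) / 128 + (5 : ℝ) * (R.Gfr 0 * |U| * Θ * ((16 : ℝ) ^
      nScales β)⁻¹)))))) ^ 26)) * (2 / ((2 * (L / 4 + 1) : ℕ) : ℝ)) ^ (26 - j - 4) * (2 ^ 2 * ∑' k : Fin 2 → ℤ, ∏ i, (1 + (k i : ℝ) ^ 2)⁻¹)))) + (L : ℝ) ^ 2 * (L : ℝ) ^ j * ((((R.Gfr 0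
      * |U| * Θ * ((16 : ℝ) ^ nScales β)⁻¹) / |(β * (L : ℝ) ^ 2)| * ((5 : ℝ) * (|(β * (L : ℝ) ^ 2)| * (6 / (klScale klE0 (nScales β + 1)))))) * ((R.Gfr 0 * |U| * Θ * ((16 : ℝ) ^
      nScales β)⁻¹) / |(β * (L : ℝ) ^ 2)| * ((5 : ℝ) * (|(β * (L : ℝ) ^ 2)| * (6 / (klScale klE0 (nScales β + 1)))))) * ((0 ! : ℝ)) ^ 2 * (2 * (2 * (2 * (2 ^ 10 * (1 : ℝ) * (4 : ℝ) ^
      nScales β) + 2 * (4 * (2 * (4 * (4 + (4 : ℝ) ^ nScales β * Ξ) * (1 + 16 * (1 + (27 / 10 : ℝ)) / (klScale klE0 (nScales β + 1)) * 1) + (2 ^ 10 * (1 : ℝ) * (4 : ℝ) ^ nScales β))) *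
      (1 + 6 / (klScale klE0 (nScales β + 1)) * ((klScale klE0 (nScales β + 1)) / 128 + (5 : ℝ) * (R.Gfr 0 * |U| * Θ * ((16 : ℝ) ^ nScales β)⁻¹))))))) ^ 0 + 2 * (((R.Gfr 0 * |U| * Θ *
      ((16 : ℝ) ^ nScales β)⁻¹) / |(β * (L : ℝ) ^ 2)|) * ((5 : ℝ) * (|(β * (L : ℝ) ^ 2)| * (6 / (klScale klE0 (nScales β + 1))))) * ((0 ! : ℝ)) ^ 2 * (2 * (2 * (2 ^ 10 * (1 : ℝ) * (4 :
      ℝ) ^ nScales β) + 2 * (4 * (2 * (4 * (4 + (4 : ℝ) ^ nScales β * Ξ) * (1 + 16 * (1 + (27 / 10 : ℝ)) / (klScale klE0 (nScales β + 1)) * 1) + (2 ^ 10 * (1 : ℝ) * (4 : ℝ) ^ nScales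
      β))) * (1 + 6 / (klScale klE0 (nScales β + 1)) * ((klScale klE0 (nScales β + 1)) / 128 + (5 : ℝ) * (R.Gfr 0 * |U| * Θ * ((16 : ℝ) ^ nScales β)⁻¹)))))) ^ 0)) * (Msb / (1 + (L : ℝ)
      / 4) ^ s)))
    (Dc := (fun i : ℕ => if i = 1 then klCurveD1 else if i = 2 then klCurveD2 else if i = 3 then klCurveD3 (R.Gfr 3 * U ^ 2 * ((4 : ℝ) ^ (nScales β + 1) / 3)) else klCurveD4 (R.Gfr 3 * U ^ 2 * ((4 : ℝ) ^ (nScales β + 1) / 3)) (R.Gfr 4 * U ^ 2 * ((16 : ℝ) ^ (nScales β + 1) / 15)))) hl1 hcB0 hD1 rowB0 rowB hDc0 hDc1 hDc2 hDc3 hDc4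
  obtain ⟨c0, c1, c2, c3, c4⟩ := bellRows_graded_le (f := fun j : ℕ => 2 * (2 * (Mmc j * ((3 : ℝ) ^ j * (((R.Gfr 0 * |U| * Θ * ((16 : ℝ) ^ nScales β)⁻¹) / |(β * (L : ℝ) ^ 2)| * ((5 : ℝ) * (|(β * (L : ℝ) ^ 2)| * (6 / (klScale klE0 (nScales β +
      1)))))) * ((R.Gfr 0 * |U| * Θ * ((16 : ℝ) ^ nScales β)⁻¹) / |(β * (L : ℝ) ^ 2)| * ((5 : ℝ) * (|(β * (L : ℝ) ^ 2)| * (6 / (klScale klE0 (nScales β + 1)))))) * ((26 ! : ℝ)) ^ 2 *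
      (2 * (2 * (2 * (2 ^ 10 * (1 : ℝ) * (4 : ℝ) ^ nScales β) + 2 * (4 * (2 * (4 * (4 + (4 : ℝ) ^ nScales β * Ξ) * (1 + 16 * (1 + (27 / 10 : ℝ)) / (klScale klE0 (nScales β + 1)) * 1) +
      (2 ^ 10 * (1 : ℝ) * (4 : ℝ) ^ nScales β))) * (1 + 6 / (klScale klE0 (nScales β + 1)) * ((klScale klE0 (nScales β + 1)) / 128 + (5 : ℝ) * (R.Gfr 0 * |U| * Θ * ((16 : ℝ) ^ nScales
      β)⁻¹))))))) ^ 26 + 2 * (((R.Gfr 0 * |U| * Θ * ((16 : ℝ) ^ nScales β)⁻¹) / |(β * (L : ℝ) ^ 2)|) * ((5 : ℝ) * (|(β * (L : ℝ) ^ 2)| * (6 / (klScale klE0 (nScales β + 1))))) * ((26 !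
      : ℝ)) ^ 2 * (2 * (2 * (2 ^ 10 * (1 : ℝ) * (4 : ℝ) ^ nScales β) + 2 * (4 * (2 * (4 * (4 + (4 : ℝ) ^ nScales β * Ξ) * (1 + 16 * (1 + (27 / 10 : ℝ)) / (klScale klE0 (nScales β + 1))
      * 1) + (2 ^ 10 * (1 : ℝ) * (4 : ℝ) ^ nScales β))) * (1 + 6 / (klScale klE0 (nScales β + 1)) * ((klScale klE0 (nScales β + 1)) / 128 + (5 : ℝ) * (R.Gfr 0 * |U| * Θ * ((16 : ℝ) ^
      nScales β)⁻¹)))))) ^ 26)) * (2 / ((2 * (L / 4 + 1) : ℕ) : ℝ)) ^ (26 - j - 4) * (2 ^ 2 * ∑' k : Fin 2 → ℤ, ∏ i, (1 + (k i : ℝ) ^ 2)⁻¹)))) + (L : ℝ) ^ 2 * (L : ℝ) ^ j * ((((R.Gfr 0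
      * |U| * Θ * ((16 : ℝ) ^ nScales β)⁻¹) / |(β * (L : ℝ) ^ 2)| * ((5 : ℝ) * (|(β * (L : ℝ) ^ 2)| * (6 / (klScale klE0 (nScales β + 1)))))) * ((R.Gfr 0 * |U| * Θ * ((16 : ℝ) ^
      nScales β)⁻¹) / |(β * (L : ℝ) ^ 2)| * ((5 : ℝ) * (|(β * (L : ℝ) ^ 2)| * (6 / (klScale klE0 (nScales β + 1)))))) * ((0 ! : ℝ)) ^ 2 * (2 * (2 * (2 * (2 ^ 10 * (1 : ℝ) * (4 : ℝ) ^
      nScales β) + 2 * (4 * (2 * (4 * (4 + (4 : ℝ) ^ nScales β * Ξ) * (1 + 16 * (1 + (27 / 10 : ℝ)) / (klScale klE0 (nScales β + 1)) * 1) + (2 ^ 10 * (1 : ℝ) * (4 : ℝ) ^ nScales β))) *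
      (1 + 6 / (klScale klE0 (nScales β + 1)) * ((klScale klE0 (nScales β + 1)) / 128 + (5 : ℝ) * (R.Gfr 0 * |U| * Θ * ((16 : ℝ) ^ nScales β)⁻¹))))))) ^ 0 + 2 * (((R.Gfr 0 * |U| * Θ *
      ((16 : ℝ) ^ nScales β)⁻¹) / |(β * (L : ℝ) ^ 2)|) * ((5 : ℝ) * (|(β * (L : ℝ) ^ 2)| * (6 / (klScale klE0 (nScales β + 1))))) * ((0 ! : ℝ)) ^ 2 * (2 * (2 * (2 ^ 10 * (1 : ℝ) * (4 :
      ℝ) ^ nScales β) + 2 * (4 * (2 * (4 * (4 + (4 : ℝ) ^ nScales β * Ξ) * (1 + 16 * (1 + (27 / 10 : ℝ)) / (klScale klE0 (nScales β + 1)) * 1) + (2 ^ 10 * (1 : ℝ) * (4 : ℝ) ^ nScales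
      β))) * (1 + 6 / (klScale klE0 (nScales β + 1)) * ((klScale klE0 (nScales β + 1)) / 128 + (5 : ℝ) * (R.Gfr 0 * |U| * Θ * ((16 : ℝ) ^ nScales β)⁻¹)))))) ^ 0)) * (Msc / (1 + (L : ℝ)
      / 4) ^ s)))
    (Dc := (fun i : ℕ => if i = 1 then klCurveD1 else if i = 2 then klCurveD2 else if i = 3 then klCurveD3 (R.Gfr 3 * U ^ 2 * ((4 : ℝ) ^ (nScales β + 1) / 3)) else klCurveD4 (R.Gfr 3 * U ^ 2 * ((4 : ℝ) ^ (nScales β + 1) / 3)) (R.Gfr 4 * U ^ 2 * ((16 : ℝ) ^ (nScales β + 1) / 15)))) hl1 hcC0 hD1 rowC0 rowC hDc0 hDc1 hDc2 hDc3 hDc4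
  obtain ⟨pb0, pb1, pb2, pb3, pb4⟩ := bellRows_graded_le (f := Mmb) (Dc := (fun i : ℕ => if i = 1 then klCurveD1 else if i = 2 then klCurveD2 else if i = 3 then klCurveD3 (R.Gfr 3 * U ^ 2 * ((4 : ℝ) ^ (nScales β + 1) / 3)) else klCurveD4 (R.Gfr 3 * U ^ 2 * ((4 : ℝ) ^ (nScales β + 1) / 3)) (R.Gfr 4 * U ^ 2 * ((16 : ℝ) ^ (nScales β + 1) / 15)))) hl1 hNmb0 hD1 hMmb0 hNmb hDc0 hDc1 hDc2 hDc3 hDc4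
  obtain ⟨pc0, pc1, pc2, pc3, pc4⟩ := bellRows_graded_le (f := Mmc) (Dc := (fun i : ℕ => if i = 1 then klCurveD1 else if i = 2 then klCurveD2 else if i = 3 then klCurveD3 (R.Gfr 3 * U ^ 2 * ((4 : ℝ) ^ (nScales β + 1) / 3)) else klCurveD4 (R.Gfr 3 * U ^ 2 * ((4 : ℝ) ^ (nScales β + 1) / 3)) (R.Gfr 4 * U ^ 2 * ((16 : ℝ) ^ (nScales β + 1) / 15)))) hl1 hNmc0 hD1 hMmc0 hNmc hDc0 hDc1 hDc2 hDc3 hDc4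
  -- the size rows
  have hP40 : (0 : ℝ) ≤ ((231 : ℝ) ^ 4 + 6 * 231 ^ 2 * 700000 + 3 * 700000 ^ 2 + 4 * 231 * (10 ^ 14 * (1 + R.Gfr 3 + R.Gfr 4)) + (10 ^ 14 * (1 + R.Gfr 3 + R.Gfr 4))) := by have := hR 3; have := hR 4; positivity
  have eP : ((231 : ℝ) ^ 4 + 6 * 231 ^ 2 * 700000 + 3 * 700000 ^ 2 + 4 * 231 * (10 ^ 14 * (1 + R.Gfr 3 + R.Gfr 4)) + (10 ^ 14 * (1 + R.Gfr 3 + R.Gfr 4))) = (1696963596321 + 925 * (10 ^ 14 * (1 + R.Gfr 3 + R.Gfr 4))) := by ring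
  have sA' : (Real.sqrt (klEngRsq R) ^ 8 / 2 ^ 17 * (U ^ 3 / β ^ 2)) * ((231 : ℝ) ^ 4 + 6 * 231 ^ 2 * 700000 + 3 * 700000 ^ 2 + 4 * 231 * (10 ^ 14 * (1 + R.Gfr 3 + R.Gfr 4)) + (10 ^ 14 * (1 + R.Gfr 3 + R.Gfr 4))) * ((4 : ℝ) ^ nScales β) ^ 2 ≤ (klEngRsq R ^ 4 * (1696963596321 + 925 * (10 ^ 14 * (1 + R.Gfr 3 + R.Gfr 4))) / 2 ^ 30) * U ^ 3 :=
    (channelConst_le hβmin (div_nonneg hS8 (by norm_num)) hP40 hU.le).trans (le_of_eq (by rw [e8]; ring))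
  have sB' : ((Nmb * Real.sqrt (klEngRsq R) ^ 8 / 2 ^ 6 + Nsb / 2 ^ 282) * (U ^ 3 / β ^ 2)) * ((231 : ℝ) ^ 4 + 6 * 231 ^ 2 * 700000 + 3 * 700000 ^ 2 + 4 * 231 * (10 ^ 14 * (1 + R.Gfr 3 + R.Gfr 4)) + (10 ^ 14 * (1 + R.Gfr 3 + R.Gfr 4))) * ((4 : ℝ) ^ nScales β) ^ 2 ≤ ((Nmb * klEngRsq R ^ 4 / 2 ^ 6 + Nsb / 2 ^ 282) * (1696963596321 + 925 * (10 ^ 14 * (1 + R.Gfr 3 + R.Gfr 4))) / 2 ^ 13) * U ^ 3 :=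
    (channelConst_le hβmin (add_nonneg (div_nonneg (mul_nonneg hNmb0 hS8) (by norm_num)) (div_nonneg hNsb0 (by norm_num))) hP40 hU.le).trans
      (le_of_eq (by rw [e8]; ring))
  have sC' : ((Nmc * Real.sqrt (klEngRsq R) ^ 8 / 2 ^ 6 + Nsc / 2 ^ 282) * (U ^ 3 / β ^ 2)) * ((231 : ℝ) ^ 4 + 6 * 231 ^ 2 * 700000 + 3 * 700000 ^ 2 + 4 * 231 * (10 ^ 14 * (1 + R.Gfr 3 + R.Gfr 4)) + (10 ^ 14 * (1 + R.Gfr 3 + R.Gfr 4))) * ((4 : ℝ) ^ nScales β) ^ 2 ≤ ((Nmc * klEngRsq R ^ 4 / 2 ^ 6 + Nsc / 2 ^ 282) * (1696963596321 + 925 * (10 ^ 14 * (1 + R.Gfr 3 + R.Gfr 4))) / 2 ^ 13) * U ^ 3 :=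
    (channelConst_le hβmin (add_nonneg (div_nonneg (mul_nonneg hNmc0 hS8) (by norm_num)) (div_nonneg hNsc0 (by norm_num))) hP40 hU.le).trans
      (le_of_eq (by rw [e8]; ring))
  have sA := fun (k : ℕ) (_ : k ≤ 4) => sizeRow_of_graded hl0 sA' k
  have sB := fun (k : ℕ) (_ : k ≤ 4) => sizeRow_of_graded hl0 sB' k
  have sC := fun (k : ℕ) (_ : k ≤ 4) => sizeRow_of_graded hl0 sC' k
  have sPb : ∀ j ≤ 4, Nmb * ((231 : ℝ) ^ 4 + 6 * 231 ^ 2 * 700000 + 3 * 700000 ^ 2 + 4 * 231 * (10 ^ 14 * (1 + R.Gfr 3 + R.Gfr 4)) + (10 ^ 14 * (1 + R.Gfr 3 + R.Gfr 4))) * ((4 : ℝ) ^ nScales β) ^ j ≤ Zb * U * ((4 : ℝ) ^ nScales β) ^ j := fun j _ =>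
    mul_le_mul_of_nonneg_right (by rw [eP]; exact hZb) (pow_nonneg hl0.le j)
  have sPc : ∀ j ≤ 4, Nmc * ((231 : ℝ) ^ 4 + 6 * 231 ^ 2 * 700000 + 3 * 700000 ^ 2 + 4 * 231 * (10 ^ 14 * (1 + R.Gfr 3 + R.Gfr 4)) + (10 ^ 14 * (1 + R.Gfr 3 + R.Gfr 4))) * ((4 : ℝ) ^ nScales β) ^ j ≤ Zc * U ^ 2 * ((4 : ℝ) ^ nScales β) ^ j / ((4 : ℝ) ^ nScales β) := fun j _ => by
    rw [le_div_iff₀ hl0]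
    calc Nmc * ((231 : ℝ) ^ 4 + 6 * 231 ^ 2 * 700000 + 3 * 700000 ^ 2 + 4 * 231 * (10 ^ 14 * (1 + R.Gfr 3 + R.Gfr 4)) + (10 ^ 14 * (1 + R.Gfr 3 + R.Gfr 4))) * ((4 : ℝ) ^ nScales β) ^ j * ((4 : ℝ) ^ nScales β) = (Nmc * ((231 : ℝ) ^ 4 + 6 * 231 ^ 2 * 700000 + 3 * 700000 ^ 2 + 4 * 231 * (10 ^ 14 * (1 + R.Gfr 3 + R.Gfr 4)) + (10 ^ 14 * (1 + R.Gfr 3 + R.Gfr 4))) * ((4 : ℝ) ^ nScales β)) * ((4 : ℝ) ^ nScales β) ^ j := by ring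
      _ ≤ (Zc * U ^ 2) * ((4 : ℝ) ^ nScales β) ^ j := mul_le_mul_of_nonneg_right (by rw [eP]; exact hZc) (pow_nonneg hl0.le j)
  exact lastResponse_bracket_flow_sharp_env hR hc hcle hU hU1 hUle hβmin hβc hμ hK hGS hQS hR0 hPh hT hW hΞ hΘ hdoor hZn le_rfl hZtU hCU
    (Mg := 26) (by norm_num) le_rfl le_rfl le_rfl le_rfl hMmb hMsb le_rfl le_rfl hMmc hMsc
    (ALa := fun j : ℕ => 2 * (2 * (1 * ((3 : ℝ) ^ j * (((R.Gfr 0 * |U| * Θ * ((16 : ℝ) ^ nScales β)⁻¹) * (R.Gfr 0 * |U| * Θ * ((16 : ℝ) ^ nScales β)⁻¹) / |(β * (L : ℝ) ^ 2)|) * ((5 : ℝ) * (|(β * (L : ℝ)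
      ^ 2)| * (6 / (klScale klE0 (nScales β + 1))))) * ((26 ! : ℝ)) ^ 2 * (2 * (2 * (2 ^ 10 * (1 : ℝ) * (4 : ℝ) ^ nScales β) + 2 * (4 * (2 * (4 * (4 + (4 : ℝ) ^ nScales β * Ξ) * (1 +
      16 * (1 + (27 / 10 : ℝ)) / (klScale klE0 (nScales β + 1)) * 1) + (2 ^ 10 * (1 : ℝ) * (4 : ℝ) ^ nScales β))) * (1 + 6 / (klScale klE0 (nScales β + 1)) * ((klScale klE0 (nScales β
      + 1)) / 128 + (5 : ℝ) * (R.Gfr 0 * |U| * Θ * ((16 : ℝ) ^ nScales β)⁻¹)))))) ^ 26) * (2 / ((2 * (L / 4 + 1) : ℕ) : ℝ)) ^ (26 - j - 4) * (2 ^ 2 * ∑' k : Fin 2 → ℤ, ∏ i, (1 + (k i :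
      ℝ) ^ 2)⁻¹)))) + (L : ℝ) ^ 2 * (L : ℝ) ^ j * ((((R.Gfr 0 * |U| * Θ * ((16 : ℝ) ^ nScales β)⁻¹) * (R.Gfr 0 * |U| * Θ * ((16 : ℝ) ^ nScales β)⁻¹) / |(β * (L : ℝ) ^ 2)|) * ((5 : ℝ) *
      (|(β * (L : ℝ) ^ 2)| * (6 / (klScale klE0 (nScales β + 1))))) * ((0 ! : ℝ)) ^ 2 * (2 * (2 * (2 ^ 10 * (1 : ℝ) * (4 : ℝ) ^ nScales β) + 2 * (4 * (2 * (4 * (4 + (4 : ℝ) ^ nScales β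
      * Ξ) * (1 + 16 * (1 + (27 / 10 : ℝ)) / (klScale klE0 (nScales β + 1)) * 1) + (2 ^ 10 * (1 : ℝ) * (4 : ℝ) ^ nScales β))) * (1 + 6 / (klScale klE0 (nScales β + 1)) * ((klScale klE0
      (nScales β + 1)) / 128 + (5 : ℝ) * (R.Gfr 0 * |U| * Θ * ((16 : ℝ) ^ nScales β)⁻¹)))))) ^ 0) * (1 / (1 + (L : ℝ) / 4) ^ s)))
    (fun j _ => le_rfl)
    (AAa := fun k : ℕ => Real.sqrt (klEngRsq R) ^ 8 / 2 ^ 17 * (U ^ 3 / β ^ 2) * ((231 : ℝ) ^ 4 + 6 * 231 ^ 2 * 700000 + 3 * 700000 ^ 2 + 4 * 231 * (10 ^ 14 * (1 + R.Gfr 3 + R.Gfr 4)) + (10 ^ 14 * (1 + R.Gfr 3 + R.Gfr 4))) * ((4 : ℝ) ^ nScales β) ^ k)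
    a0 a1 a2 a3 a4
    (ALb := fun j : ℕ => 2 * (2 * (Mmb j * ((3 : ℝ) ^ j * (((R.Gfr 0 * |U| * Θ * ((16 : ℝ) ^ nScales β)⁻¹) / |(β * (L : ℝ) ^ 2)| * ((5 : ℝ) * (|(β * (L : ℝ) ^ 2)| * (6 / (klScale klE0 (nScales β +
      1)))))) * ((R.Gfr 0 * |U| * Θ * ((16 : ℝ) ^ nScales β)⁻¹) / |(β * (L : ℝ) ^ 2)| * ((5 : ℝ) * (|(β * (L : ℝ) ^ 2)| * (6 / (klScale klE0 (nScales β + 1)))))) * ((26 ! : ℝ)) ^ 2 *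
      (2 * (2 * (2 * (2 ^ 10 * (1 : ℝ) * (4 : ℝ) ^ nScales β) + 2 * (4 * (2 * (4 * (4 + (4 : ℝ) ^ nScales β * Ξ) * (1 + 16 * (1 + (27 / 10 : ℝ)) / (klScale klE0 (nScales β + 1)) * 1) +
      (2 ^ 10 * (1 : ℝ) * (4 : ℝ) ^ nScales β))) * (1 + 6 / (klScale klE0 (nScales β + 1)) * ((klScale klE0 (nScales β + 1)) / 128 + (5 : ℝ) * (R.Gfr 0 * |U| * Θ * ((16 : ℝ) ^ nScales
      β)⁻¹))))))) ^ 26 + 2 * (((R.Gfr 0 * |U| * Θ * ((16 : ℝ) ^ nScales β)⁻¹) / |(β * (L : ℝ) ^ 2)|) * ((5 : ℝ) * (|(β * (L : ℝ) ^ 2)| * (6 / (klScale klE0 (nScales β + 1))))) * ((26 !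
      : ℝ)) ^ 2 * (2 * (2 * (2 ^ 10 * (1 : ℝ) * (4 : ℝ) ^ nScales β) + 2 * (4 * (2 * (4 * (4 + (4 : ℝ) ^ nScales β * Ξ) * (1 + 16 * (1 + (27 / 10 : ℝ)) / (klScale klE0 (nScales β + 1))
      * 1) + (2 ^ 10 * (1 : ℝ) * (4 : ℝ) ^ nScales β))) * (1 + 6 / (klScale klE0 (nScales β + 1)) * ((klScale klE0 (nScales β + 1)) / 128 + (5 : ℝ) * (R.Gfr 0 * |U| * Θ * ((16 : ℝ) ^
      nScales β)⁻¹)))))) ^ 26)) * (2 / ((2 * (L / 4 + 1) : ℕ) : ℝ)) ^ (26 - j - 4) * (2 ^ 2 * ∑' k : Fin 2 → ℤ, ∏ i, (1 + (k i : ℝ) ^ 2)⁻¹)))) + (L : ℝ) ^ 2 * (L : ℝ) ^ j * ((((R.Gfr 0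
      * |U| * Θ * ((16 : ℝ) ^ nScales β)⁻¹) / |(β * (L : ℝ) ^ 2)| * ((5 : ℝ) * (|(β * (L : ℝ) ^ 2)| * (6 / (klScale klE0 (nScales β + 1)))))) * ((R.Gfr 0 * |U| * Θ * ((16 : ℝ) ^
      nScales β)⁻¹) / |(β * (L : ℝ) ^ 2)| * ((5 : ℝ) * (|(β * (L : ℝ) ^ 2)| * (6 / (klScale klE0 (nScales β + 1)))))) * ((0 ! : ℝ)) ^ 2 * (2 * (2 * (2 * (2 ^ 10 * (1 : ℝ) * (4 : ℝ) ^
      nScales β) + 2 * (4 * (2 * (4 * (4 + (4 : ℝ) ^ nScales β * Ξ) * (1 + 16 * (1 + (27 / 10 : ℝ)) / (klScale klE0 (nScales β + 1)) * 1) + (2 ^ 10 * (1 : ℝ) * (4 : ℝ) ^ nScales β))) *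
      (1 + 6 / (klScale klE0 (nScales β + 1)) * ((klScale klE0 (nScales β + 1)) / 128 + (5 : ℝ) * (R.Gfr 0 * |U| * Θ * ((16 : ℝ) ^ nScales β)⁻¹))))))) ^ 0 + 2 * (((R.Gfr 0 * |U| * Θ *
      ((16 : ℝ) ^ nScales β)⁻¹) / |(β * (L : ℝ) ^ 2)|) * ((5 : ℝ) * (|(β * (L : ℝ) ^ 2)| * (6 / (klScale klE0 (nScales β + 1))))) * ((0 ! : ℝ)) ^ 2 * (2 * (2 * (2 ^ 10 * (1 : ℝ) * (4 :
      ℝ) ^ nScales β) + 2 * (4 * (2 * (4 * (4 + (4 : ℝ) ^ nScales β * Ξ) * (1 + 16 * (1 + (27 / 10 : ℝ)) / (klScale klE0 (nScales β + 1)) * 1) + (2 ^ 10 * (1 : ℝ) * (4 : ℝ) ^ nScales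
      β))) * (1 + 6 / (klScale klE0 (nScales β + 1)) * ((klScale klE0 (nScales β + 1)) / 128 + (5 : ℝ) * (R.Gfr 0 * |U| * Θ * ((16 : ℝ) ^ nScales β)⁻¹)))))) ^ 0)) * (Msb / (1 + (L : ℝ)
      / 4) ^ s)))
    (fun j _ => le_rfl)
    (PPb := fun j : ℕ => Nmb * ((231 : ℝ) ^ 4 + 6 * 231 ^ 2 * 700000 + 3 * 700000 ^ 2 + 4 * 231 * (10 ^ 14 * (1 + R.Gfr 3 + R.Gfr 4)) + (10 ^ 14 * (1 + R.Gfr 3 + R.Gfr 4))) * ((4 : ℝ) ^ nScales β) ^ j) pb0 pb1 pb2 pb3 pb4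
    (AAb := fun k : ℕ => (Nmb * Real.sqrt (klEngRsq R) ^ 8 / 2 ^ 6 + Nsb / 2 ^ 282) * (U ^ 3 / β ^ 2) * ((231 : ℝ) ^ 4 + 6 * 231 ^ 2 * 700000 + 3 * 700000 ^ 2 + 4 * 231 * (10 ^ 14 * (1 + R.Gfr 3 + R.Gfr 4)) + (10 ^ 14 * (1 + R.Gfr 3 + R.Gfr 4))) * ((4 : ℝ) ^ nScales β) ^ k)
    b0 b1 b2 b3 b4
    (ALc := fun j : ℕ => 2 * (2 * (Mmc j * ((3 : ℝ) ^ j * (((R.Gfr 0 * |U| * Θ * ((16 : ℝ) ^ nScales β)⁻¹) / |(β * (L : ℝ) ^ 2)| * ((5 : ℝ) * (|(β * (L : ℝ) ^ 2)| * (6 / (klScale klE0 (nScales β +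
      1)))))) * ((R.Gfr 0 * |U| * Θ * ((16 : ℝ) ^ nScales β)⁻¹) / |(β * (L : ℝ) ^ 2)| * ((5 : ℝ) * (|(β * (L : ℝ) ^ 2)| * (6 / (klScale klE0 (nScales β + 1)))))) * ((26 ! : ℝ)) ^ 2 *
      (2 * (2 * (2 * (2 ^ 10 * (1 : ℝ) * (4 : ℝ) ^ nScales β) + 2 * (4 * (2 * (4 * (4 + (4 : ℝ) ^ nScales β * Ξ) * (1 + 16 * (1 + (27 / 10 : ℝ)) / (klScale klE0 (nScales β + 1)) * 1) +
      (2 ^ 10 * (1 : ℝ) * (4 : ℝ) ^ nScales β))) * (1 + 6 / (klScale klE0 (nScales β + 1)) * ((klScale klE0 (nScales β + 1)) / 128 + (5 : ℝ) * (R.Gfr 0 * |U| * Θ * ((16 : ℝ) ^ nScales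
      β)⁻¹))))))) ^ 26 + 2 * (((R.Gfr 0 * |U| * Θ * ((16 : ℝ) ^ nScales β)⁻¹) / |(β * (L : ℝ) ^ 2)|) * ((5 : ℝ) * (|(β * (L : ℝ) ^ 2)| * (6 / (klScale klE0 (nScales β + 1))))) * ((26 !
      : ℝ)) ^ 2 * (2 * (2 * (2 ^ 10 * (1 : ℝ) * (4 : ℝ) ^ nScales β) + 2 * (4 * (2 * (4 * (4 + (4 : ℝ) ^ nScales β * Ξ) * (1 + 16 * (1 + (27 / 10 : ℝ)) / (klScale klE0 (nScales β + 1))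
      * 1) + (2 ^ 10 * (1 : ℝ) * (4 : ℝ) ^ nScales β))) * (1 + 6 / (klScale klE0 (nScales β + 1)) * ((klScale klE0 (nScales β + 1)) / 128 + (5 : ℝ) * (R.Gfr 0 * |U| * Θ * ((16 : ℝ) ^
      nScales β)⁻¹)))))) ^ 26)) * (2 / ((2 * (L / 4 + 1) : ℕ) : ℝ)) ^ (26 - j - 4) * (2 ^ 2 * ∑' k : Fin 2 → ℤ, ∏ i, (1 + (k i : ℝ) ^ 2)⁻¹)))) + (L : ℝ) ^ 2 * (L : ℝ) ^ j * ((((R.Gfr 0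
      * |U| * Θ * ((16 : ℝ) ^ nScales β)⁻¹) / |(β * (L : ℝ) ^ 2)| * ((5 : ℝ) * (|(β * (L : ℝ) ^ 2)| * (6 / (klScale klE0 (nScales β + 1)))))) * ((R.Gfr 0 * |U| * Θ * ((16 : ℝ) ^
      nScales β)⁻¹) / |(β * (L : ℝ) ^ 2)| * ((5 : ℝ) * (|(β * (L : ℝ) ^ 2)| * (6 / (klScale klE0 (nScales β + 1)))))) * ((0 ! : ℝ)) ^ 2 * (2 * (2 * (2 * (2 ^ 10 * (1 : ℝ) * (4 : ℝ) ^
      nScales β) + 2 * (4 * (2 * (4 * (4 + (4 : ℝ) ^ nScales β * Ξ) * (1 + 16 * (1 + (27 / 10 : ℝ)) / (klScale klE0 (nScales β + 1)) * 1) + (2 ^ 10 * (1 : ℝ) * (4 : ℝ) ^ nScales β))) *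
      (1 + 6 / (klScale klE0 (nScales β + 1)) * ((klScale klE0 (nScales β + 1)) / 128 + (5 : ℝ) * (R.Gfr 0 * |U| * Θ * ((16 : ℝ) ^ nScales β)⁻¹))))))) ^ 0 + 2 * (((R.Gfr 0 * |U| * Θ *
      ((16 : ℝ) ^ nScales β)⁻¹) / |(β * (L : ℝ) ^ 2)|) * ((5 : ℝ) * (|(β * (L : ℝ) ^ 2)| * (6 / (klScale klE0 (nScales β + 1))))) * ((0 ! : ℝ)) ^ 2 * (2 * (2 * (2 ^ 10 * (1 : ℝ) * (4 :
      ℝ) ^ nScales β) + 2 * (4 * (2 * (4 * (4 + (4 : ℝ) ^ nScales β * Ξ) * (1 + 16 * (1 + (27 / 10 : ℝ)) / (klScale klE0 (nScales β + 1)) * 1) + (2 ^ 10 * (1 : ℝ) * (4 : ℝ) ^ nScales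
      β))) * (1 + 6 / (klScale klE0 (nScales β + 1)) * ((klScale klE0 (nScales β + 1)) / 128 + (5 : ℝ) * (R.Gfr 0 * |U| * Θ * ((16 : ℝ) ^ nScales β)⁻¹)))))) ^ 0)) * (Msc / (1 + (L : ℝ)
      / 4) ^ s)))
    (fun j _ => le_rfl)
    (PPc := fun j : ℕ => Nmc * ((231 : ℝ) ^ 4 + 6 * 231 ^ 2 * 700000 + 3 * 700000 ^ 2 + 4 * 231 * (10 ^ 14 * (1 + R.Gfr 3 + R.Gfr 4)) + (10 ^ 14 * (1 + R.Gfr 3 + R.Gfr 4))) * ((4 : ℝ) ^ nScales β) ^ j) pc0 pc1 pc2 pc3 pc4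
    (AAc := fun k : ℕ => (Nmc * Real.sqrt (klEngRsq R) ^ 8 / 2 ^ 6 + Nsc / 2 ^ 282) * (U ^ 3 / β ^ 2) * ((231 : ℝ) ^ 4 + 6 * 231 ^ 2 * 700000 + 3 * 700000 ^ 2 + 4 * 231 * (10 ^ 14 * (1 + R.Gfr 3 + R.Gfr 4)) + (10 ^ 14 * (1 + R.Gfr 3 + R.Gfr 4))) * ((4 : ℝ) ^ nScales β) ^ k)
    c0 c1 c2 c3 c4 sPb sPc sA sB sC

end FlowFinalGraded

end Summit.HubbardSuperconductivity.HubbardSuperconductivity.Theorems.EngineV8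

end
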